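import Literature.AlgebraicGeometry.Hyperkaehler.GeneralizedKummerAutFixingH2H3
import Literature.AlgebraicGeometry.Hyperkaehler.LLVGenerationTransport
import HarnessLib

/-!
# `im θ^* ⊆ H*(Kⁿ(A)(ℂ); ℂ)^{Γ(Kⁿ(A))}` on the total cohomology (proved modulo the BNWS–Oguiso–Foster fact)

Layer `Literature/AlgebraicGeometry/Hyperkaehler`; theorems only, no definition, no named fact.  Rider on
`GeneralizedKummerAutFixingH2H3` (the NAMED FACT `BNWS2011_autFixingH2H3_generalizedKummer`: `Γ(Kⁿ(A))` = the
Kummer translations `τ_b`, `b ∈ A[n+1]`, `n ≥ 2`, and its degreewise consequences `θ^* ≫ τ_b^* = θ^*`,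
`θ^* ≫ g^* = θ^*` for `g ∈ Γ(K)` on each `Hᵏ`) and on `LLVGenerationTransport` (`totalPullback R f : H*(Y') → H*(Y)`
on the total cohomology `H* = ⨁ₖ Hᵏ`, `totalPullback_comp`, and `invariantClasses R 𝓕 = {v | f^* v = v ∀ f ∈ 𝓕}`),
restating those consequences on the TOTAL cohomology — the form in which the lane-(V) bridge
"`im θ^* = H*(K)^{Γ(K)}`" (`LinearMap.range (totalPullback ℂ θ(ℂ)) = invariantClasses ℂ {g(ℂ) | g ∈ Γ(K)}`) is stated:

* `HilbertScheme.IsTranslationAction.totalPullback_translateHilb` — `(t_a^{[n]})^* = id` on `H*(A^[n](ℂ); ℂ)`;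
* `HilbertScheme.IsKummerTranslation.totalPullback_comp_totalPullback` (`_apply`) — `τ_b^* ∘ θ^* = θ^*` on `H*`
  (fact-free, any `b`);
* `HilbertScheme.IsTranslationAction.totalPullback_sliceOne_comp_kummerCover` — `(1, 𝟙_K)^* ∘ Θ^* = θ^*` on `H*`
  (the restriction step of the other inclusion `im θ^* ⊇ H*(K)^{A[n+1]}`, whose remaining inputs are the Galois
  cover `HilbertScheme.Beauville1983_kummerCover_galois`, the tree's finite-cover transfer and Künneth — prover work,
  not here);
* `BNWS2011_autFixingH2H3_generalizedKummer.range_totalPullback_le_invariantClasses` — **modulo the fact,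
  `im θ^* ⊆ H*(K(ℂ); ℂ)^{Γ(K)}`**, the right-hand side being `invariantClasses ℂ` of the family `g(ℂ)`,
  `g ∈ autFixingH2H3 K` (verbatim the body of the Summits-side `gammaInvariantClasses K`).

[cite: BoissiereNieperWisskirchenSarti2011, Cor. 3.3 (2) and its proof] [cite: Beauville1983, §7 p. 769]
-/

noncomputable section

open CategoryTheory MonoidalCategory CartesianMonoidalCategory
open Literature.AlgebraicGeometry.Motives (SchemeOver AbelianVariety ComplexPoints)
open Literature.AlgebraicGeometry.HodgeTheory (complexBetti)
open Literature.AlgebraicGeometry.HilbertScheme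
open scoped MonObj

namespace Literature.AlgebraicGeometry.Hyperkaehler

variable {A : AbelianVariety ℂ} {K H : SchemeOver ℂ} {n : ℕ} {Ξ : (A.X ⊗ H).left.IdealSheafData}
  {act : A.X ⊗ H ⟶ H} {j : K ⟶ H}

/-- **`(t_a^{[n]})^* = id` on the total cohomology `H*(A^[n](ℂ); ℂ)`** (the degreewise
`IsTranslationAction.complexBetti_map_translateHilb`, assembled over `⨁ₖ Hᵏ`). [cite: Beauville1983, §7 p. 769] -/
theorem _root_.Literature.AlgebraicGeometry.HilbertScheme.IsTranslationAction.totalPullback_translateHilb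
    (hH : IsHilbertSchemeOfPoints n A.X H Ξ) (hact : IsTranslationAction Ξ act) (a : 𝟙_ (SchemeOver ℂ) ⟶ A.X) :
    totalPullback ℂ (Motives.AlgPoints.mapContinuous (L := ℂ) (translateHilb act a)) = LinearMap.id := by
  refine DirectSum.linearMap_ext ℂ fun k ↦ LinearMap.ext fun x ↦ ?_
  simp only [LinearMap.coe_comp, Function.comp_apply, totalPullback_lof, LinearMap.id_coe, id_eq]
  exact congrArg _ (hact.complexBetti_map_translateHilb_apply hH a k x)

/-- **A Kummer translation fixes `im θ^*` pointwise on the total cohomology**: `τ_b^* ∘ θ^* = θ^*` on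
`H*(K(ℂ); ℂ)` (fact-free; `b` need not be torsion).
[cite: BoissiereNieperWisskirchenSarti2011, Cor. 3.3 (proof of (2))] [cite: Beauville1983, §7 p. 769] -/
theorem _root_.Literature.AlgebraicGeometry.HilbertScheme.IsKummerTranslation.totalPullback_comp_totalPullback
    (hH : IsHilbertSchemeOfPoints n A.X H Ξ) (hact : IsTranslationAction Ξ act) {b : 𝟙_ (SchemeOver ℂ) ⟶ A.X}
    {τ : K ⟶ K} (hτ : IsKummerTranslation act j b τ) :
    totalPullback ℂ (Motives.AlgPoints.mapContinuous (L := ℂ) τ) ∘ₗ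
        totalPullback ℂ (Motives.AlgPoints.mapContinuous (L := ℂ) j) =
      totalPullback ℂ (Motives.AlgPoints.mapContinuous (L := ℂ) j) := by
  rw [← totalPullback_comp, ← Motives.AlgPoints.mapContinuous_comp, hτ, Motives.AlgPoints.mapContinuous_comp,
    totalPullback_comp, hact.totalPullback_translateHilb hH, LinearMap.comp_id]

/-- Pointwise: `τ_b^*(θ^* x) = θ^* x` on `H*`. [cite: BoissiereNieperWisskirchenSarti2011, Cor. 3.3 (proof of (2))] -/
theorem _root_.Literature.AlgebraicGeometry.HilbertScheme.IsKummerTranslation.totalPullback_totalPullback_apply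
    (hH : IsHilbertSchemeOfPoints n A.X H Ξ) (hact : IsTranslationAction Ξ act) {b : 𝟙_ (SchemeOver ℂ) ⟶ A.X}
    {τ : K ⟶ K} (hτ : IsKummerTranslation act j b τ) (x : totalCohomology ℂ (ComplexPoints H)) :
    totalPullback ℂ (Motives.AlgPoints.mapContinuous (L := ℂ) τ)
        (totalPullback ℂ (Motives.AlgPoints.mapContinuous (L := ℂ) j) x) =
      totalPullback ℂ (Motives.AlgPoints.mapContinuous (L := ℂ) j) x := by
  rw [← LinearMap.comp_apply, hτ.totalPullback_comp_totalPullback hH hact]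

/-- **`(1, 𝟙_K)^* ∘ Θ^* = θ^*` on the total cohomology** (the restriction step of `im θ^* ⊇ H*(K)^{A[n+1]}`;
degreewise `IsTranslationAction.complexBetti_map_kummerCover_comp_sliceOne`).
[cite: Beauville1983, §7 p. 769 footnote 2] -/
theorem _root_.Literature.AlgebraicGeometry.HilbertScheme.IsTranslationAction.totalPullback_sliceOne_comp_kummerCover
    (hH : IsHilbertSchemeOfPoints n A.X H Ξ) (hact : IsTranslationAction Ξ act) (j : K ⟶ H) :
    totalPullback ℂ (Motives.AlgPoints.mapContinuous (L := ℂ)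
        (lift (toUnit K ≫ (1 : 𝟙_ (SchemeOver ℂ) ⟶ A.X)) (𝟙 K))) ∘ₗ
        totalPullback ℂ (Motives.AlgPoints.mapContinuous (L := ℂ) (kummerCover act j)) =
      totalPullback ℂ (Motives.AlgPoints.mapContinuous (L := ℂ) j) := by
  rw [← totalPullback_comp, hact.mapContinuous_kummerCover_comp_sliceOne hH j]

/-- **`im θ^* ⊆ H*(K(ℂ); ℂ)^{Γ(K)}` on the total cohomology** (the easy inclusion of the lane-(V) bridge, modulo
the fact): every `g ∈ Γ(K)` is a Kummer translation (clause (2)), and Kummer translations fix `im θ^*`.  The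
right-hand side is `invariantClasses` of the family `g(ℂ)`, `g ∈ autFixingH2H3 K` — verbatim the body of the
Summits-side `gammaInvariantClasses K`. [cite: BoissiereNieperWisskirchenSarti2011, Cor. 3.3]
[cite: Oguiso2020CohomologicallyTrivialKummer, Lemma 3.4] -/
theorem BNWS2011_autFixingH2H3_generalizedKummer.range_totalPullback_le_invariantClasses
    (h : BNWS2011_autFixingH2H3_generalizedKummer) (hA : A.dim = 2) (hn : 2 ≤ n)
    (hH : IsHilbertSchemeOfPoints (n + 1) A.X H Ξ) (hHs : Motives.IsSmoothProjective (2 * (n + 1)) H)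
    {𝒜 : Motives.Jacobian H} {x₀ : 𝟙_ (SchemeOver ℂ) ⟶ H}
    (hsq : IsPullback j (toUnit K) (lift (𝟙 H) (toUnit H ≫ x₀) ≫ 𝒜.diff) (1 : 𝟙_ (SchemeOver ℂ) ⟶ 𝒜.J.X))
    (hKs : Motives.IsSmoothProjective (2 * n) K) (hact : IsTranslationAction Ξ act) :
    LinearMap.range (totalPullback ℂ (Motives.AlgPoints.mapContinuous (L := ℂ) j)) ≤
      invariantClasses ℂ
        (Set.range fun g : autFixingH2H3 K ↦ Motives.AlgPoints.mapContinuous (L := ℂ) g.val.hom) := by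
  rintro _ ⟨x, rfl⟩
  rw [mem_invariantClasses_iff]
  rintro _ ⟨g, rfl⟩
  obtain ⟨b, -, hτ⟩ := (h hA hn Ξ 𝒜 x₀ j act hH hHs hsq hKs hact).2 g.val g.property
  exact hτ.totalPullback_totalPullback_apply hH hact x

end Literature.AlgebraicGeometry.Hyperkaehler

end
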